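import Summits.ResolutionOfSingularities.ResolutionOfSingularities.Theorems.EquisingularLiftEquisingularLiftNatLargeCharStrongHyp
import Literature.AlgebraicGeometry.Resolution.GenericPointStalkData
import Mathlib.RingTheory.Ideal.IdempotentFG
import HarnessLib

/-!
# [OURS · L1 W4.5(b) · EL♮ · RUNG LC «large characteristic», brick (B2-K), corollary] THE STAGE-ZERO FORM: A REDUCED HYPERSURFACE IN CHARACTERISTIC
# ZERO HAS AN EMBEDDED RESOLUTION WORD `DescTransformOK t (𝟙 X) V(I) V(I)` WITH SMOOTH CENTRES

res-L1-w45b-stub-4 g17 (STUB WORKER 4; desk R96 (1) «(B2-K) YES as named»; companion of ✓ `…NatLargeCharStrongHyp`).  Crux context EL♮(3) =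
stmt-ResolutionOfSingularities-20148 (parent EL♮ stmt-…-20038; bookkeeping crux stmt-…-15660).  OURS; NOT a statement of any manuscript ([Hironaka2017] is a
candidate under adjudication, nothing of it is asserted or imported); AI-written, weaker than expert review.  DEF-FREE; no `sorry`; standard axioms;
`--supports stmt-…-20148 --as helper`, counted 0.  Characteristic ZERO only; EL♮(3) / EL♮ / `EquisingularLift` NOT proved.

WHAT.  The side clause `hgen` of ★ `LargeChar.exists_centreSeq_descTransformOK` — «order `≤ 1` over the generic point of `Y₀`» — discharged in the
stage-zero situation of the descent door (`σ = 𝟙`, `Y₀ = V(I)`): for a REDUCED hypersurface `V(I)` (effective Cartier `I` with `V(I)` reduced) of a regular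
locally Noetherian scheme, the order of `I` at a generic point of `V(I)` is `≤ 1` (`I_ξ = 𝓘⟨V(I)⟩_ξ = 𝔪_ξ`, and `𝔪_ξ ⊄ 𝔪_ξ²` by Nakayama since `I_ξ ≠ 0`):
`LargeChar.idealOrder_le_one_of_isGenericPoint`.  Hence ★ `LargeChar.exists_centreSeq_descTransformOK_self`: for `K` of characteristic `0`, `X` integral
regular of finite type over `K`, `I` effective Cartier with `V(I)` reduced, there is `t : CentreSeq X` with `DescCentresSmoothOver t s`, `t.ExceptionalFlatOver s`
and `DescTransformOK t (𝟙 X) V(I) V(I)` — literally the k-side token of ✓ `DescDoorOver` read over `K` (with `Set.range ι = V(ι.ker)` for a closed immersion `ι`).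
[cite: Kollar2007, Thm. 3.69 and 3.58–3.60] [cite: StacksProject, Tag 00NQ] (method; index only).
-/

set_option linter.dupNamespace false -- mandated namespace `Summit.<Summit>.<Problem>` of this single-conjunct summit

noncomputable section

open CategoryTheory CategoryTheory.Limits AlgebraicGeometry TopologicalSpace Topology IsLocalRing
open Literature.AlgebraicGeometry.Resolution
open AlgebraicGeometry.Scheme.IdealSheafData

namespace Summit.ResolutionOfSingularities.ResolutionOfSingularities.Cruxes.EquisingularLiftNat.Sections

namespace LargeChar

/-- **Order `≤ 1` at a generic point of a reduced hypersurface.**  `X` regular at `ξ`, `I` an ideal sheaf with `V(I)` reduced and `I_ξ ≠ 0`, `ξ` a generic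
point of `V(I)` (so `V(I)` irreducible): `ord_ξ I ≤ 1`.  (`I = 𝓘⟨V(I)⟩` is the vanishing ideal of the closure of `ξ`, whose stalk at `ξ` is `𝔪_ξ`; if
`𝔪_ξ ⊆ 𝔪_ξ²` then `𝔪_ξ` is idempotent, hence zero in the domain `𝒪_{X,ξ}`, contradicting `I_ξ ≠ 0`.) [cite: StacksProject, Tag 00NQ] -/
theorem idealOrder_le_one_of_isGenericPoint {X : Scheme.{0}} {I : X.IdealSheafData} [IsReduced I.subscheme] {ξ : X}
    [IsRegularLocalRing (X.presheaf.stalk ξ)] (hξ : IsGenericPoint ξ (I.support : Set X)) (h0 : stalkIdeal I ξ ≠ ⊥) :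
    idealOrder I ξ ≤ 1 := by
  have hI : I = vanishingIdeal I.support := (eq_vanishingIdeal_support_of_isReduced_subscheme I).symm
  have hst : stalkIdeal I ξ = maximalIdeal (X.presheaf.stalk ξ) := by
    rw [hI]
    exact stalkIdeal_vanishingIdeal_eq_maximalIdeal_of_closure_eq (Y := I.support) hξ.symm
  by_contra h
  have h2 : (2 : ℕ∞) ≤ idealOrder I ξ := by
    rw [not_le] at h
    exact Order.add_one_le_of_lt h
  have hle : stalkIdeal I ξ ≤ maximalIdeal (X.presheaf.stalk ξ) ^ 2 := by
    rw [← le_idealOrder_iff]; exact_mod_cast h2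
  rw [hst] at hle
  haveI := isDomain_of_isRegularLocalRing (X.presheaf.stalk ξ)
  have hidem : IsIdempotentElem (maximalIdeal (X.presheaf.stalk ξ)) :=
    le_antisymm Ideal.mul_le_right (by rw [← pow_two]; exact hle)
  rcases (Ideal.isIdempotentElem_iff_eq_bot_or_top _ (IsNoetherian.noetherian _)).mp hidem with hbot | htop
  · exact h0 (hst.trans hbot)
  · exact (maximalIdeal.isMaximal _).ne_top htop

variable {K : Type} [Field K] [CharZero K]

/-- ★ **(B2-K), stage-zero form — a reduced hypersurface in characteristic zero has an embedded resolution word with smooth centres inside the running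
strict transforms: `DescTransformOK t (𝟙 X) V(I) V(I)`.**  `K` of characteristic `0`; `X` integral, regular, of finite type over `K`; `I` effective
Cartier with `V(I)` reduced. [cite: Kollar2007, Thm. 3.69 (p. 150) and 3.58–3.60] -/
theorem exists_centreSeq_descTransformOK_self {X : Scheme.{0}} (s : X ⟶ Spec (.of K)) [LocallyOfFiniteType s] [QuasiCompact s] [IsIntegral X]
    (hreg : Scheme.IsRegular X) {I : X.IdealSheafData} (hI : IsEffectiveCartier I) [IsReduced I.subscheme] :
    ∃ t : CentreSeq X, DescCentresSmoothOver t s ∧ t.ExceptionalFlatOver s ∧ DescTransformOK t (𝟙 X) (I.support : Set X) (I.support : Set X) := by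
  refine exists_centreSeq_descTransformOK (I.support : Set X) s hreg hI (𝟙 X) fun x hx => ?_
  haveI : IsRegularLocalRing (X.presheaf.stalk x) := hreg x
  have hx' : IsGenericPoint x (I.support : Set X) := by simpa using hx
  exact idealOrder_le_one_of_isGenericPoint hx' (stalkIdeal_ne_bot_of_isEffectiveCartier hI x)

end LargeChar

end Summit.ResolutionOfSingularities.ResolutionOfSingularities.Cruxes.EquisingularLiftNat.Sections

end
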